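import Literature.MathematicalPhysics.QuantumFieldTheory.Balaban1983to89.B6V1TorusWitness
import Literature.MathematicalPhysics.QuantumFieldTheory.Balaban1983to89.B6CubeWindowV1
import HarnessLib

/-!
# `Balaban1983to89.B6KLevelFamilyWitnessV1` — T. Bałaban, *Propagators and renormalization transformations for lattice gauge theories. II*,
Comm. Math. Phys. **96** (1984) 223–250 [Balaban1984PropagatorsII], (2.1)–(2.4) p. 224 and (2.16) p. 225: **NON-VACUITY OF THE FULL BINDER LIST OF THE
k-LEVEL THEOREMS OF ROUTES V/W ON THE V1 TORUS** — the hypothesis set shared VERBATIM by `B6Line3CubeV1.prop26_2136_kLevel_unconditional` ((2.136)₁),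
`B6Prop26GradKLevelV1.prop26_2136_grad_kLevel_unconditional` ((2.136)₁,₂), `B6Prop27KLevelV1.prop27_kLevel` / `B6QGQCoerciveKLevelV1.prop27_kLevel_unconditional`
((2.149)) and `B6Cor28EntriesKLevelV1.cor28_kLevel_H(_DH)` ((2.151)₁,₂): `hN` (the torus IS the V1 torus), `k ≤ m + K`, `2 ≤ k`, `M_h = L^a ≥ 8`,
`R ≥ 2L²`, `P′_μ ≥ 5`, `4 ≤ ℓ`, `Placed` for every cube, `M₂ ≤ L·M_h`, `N₁ + 1 ≤ R·L·M_h` (beyond EVERY pair of thresholds `M₂`, `N₁`),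
`c_f ≠ 0`, weights `w > 0` in the band (2.16) `GlobalBand b₀ b₁ c_f w` — is INHABITED at `L = 5`, for every `d` and every `k ≥ 2`, by a family with
sites at BOTH top levels `k` and `k − 1` (p21's two-top-level function, p22's `B6V1TorusWitness.exists_twoTop_TDomains`).

HONEST FRAMING (programme rule): statement-level skeleton of published theorems with citation tags; proofs where landed; nothing here
is a claim about the Yang–Mills mass gap.

WHAT IS PRINTED (p. 224): «We admit the case when some domains Ω_j are equal to T_η»; (2.2) «M is a size of big blocks … which will be fixed
later»; (2.16) the weight band.  p22's `B6V1TorusWitness.v1Torus_nonvacuous` inhabits the OLDER binder list (`P′ ≥ 4`, `R ≥ 2L`, one threshold);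
this file inhabits the CURRENT one (the (2.2)-strength `R ≥ 2L²`, `M_h = L^a ≥ 8`, `P′ ≥ 5`, the chart condition `Placed` of every cube — automatic at
`L = 5`, `P′ ≥ 12` by `B6CubeWindowV1.placed_all_cubes` —, both thresholds, and the band).

## WHAT THIS FILE CERTIFIES (kernel-checked, sorry-free, standard axioms; THEOREMS ONLY)

* `N0_V1_pow`: with `M_h = L^a`, `P′_μ = 2L^s`, `m + K = k + a + 1 + s` the torus side `N₀` is the V1 side `2L^{m+K}` (p22's `N0_V1` = `s = 1`);
* `globalBand_witness`: at `c_f = 1` the weight `w_i = b₀·L^{j(i)D}·L^{−2j(i)}` is positive and lies in the band `[b₀, b₁]` (2.16);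
* **`kLevelFamily_nonvacuous_L5`**: for `L = 5` (`ℓ = 4`), every `d`, `k ≥ 2`, `M₂`, `N₁`, `0 < b₀ ≤ b₁` there are `m, K, M_h, R, a, P′`, `hN`, a nested torus
  family `D`, `k ≤ m + K` and weights `w` meeting EVERY binder of the k-level theorems above, with sites at levels `k` and `k − 1`.

## HONEST SCOPE

(1) Two top levels only (`Ω₁ = … = Ω_{k−1} = T_η`, `Ω_k` = one big block): (2.2) is void for this member, exactly as for p21's/p22's witnesses —
the witness certifies joint satisfiability of the binder list, not a family with all `k` levels separated.  (2) `L = 5` only: for odd `L ≥ 7` the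
canonical index-`2` chart does not place the top cubes (`B6CubeWindowV1.placed_top` needs `L ≤ 5`; honest scope (3) there).  NOT summit progress.
Unit `lit-balaban-r03` (gen 24), 2026-08-23.  v1.1 (doc-only, referee ref-4 D-g76-4): the two p. 224 / p. 234 quotations
made verbatim with their own locators; no declaration touched.
-/

namespace Literature.MathematicalPhysics.QuantumFieldTheory.Balaban1983to89.B6KLevelFamilyWitnessV1

open B4Reflection242 (boxDom mem_boxDom)
open B6MultiLevelBoxOperator (N0)
open B6MultiLevelTorusOperator (TDomains)
open B6GlobalChartV1 (PV domT)
open B6SectAOperatorsV1 (BondIdx)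
open B6CubeWindowV1 (Placed GlobalBand placed_all_cubes)
open B6Cover236MultiLevelBlocks (cubes)
open B6V1TorusWitness (topLev_zero topLev_corner corner_mem_boxDom exists_twoTop_TDomains)

variable {d : ℕ}

/-! ## §1 The torus size with `P′ = 2L^s` -/

/-- **THE V1 TORUS IS A (2.1)-TORUS** for every exponent `s`: with `M_h = L^a`, `P′_μ = 2L^s` and `m + K = k + a + 1 + s` the torus side
`N₀ = L^k·L·M_h·P′ = 2L^{m+K}`. [cite: Balaban1984PropagatorsII, (2.1) p.224, dictionary] -/
theorem N0_V1_pow (ℓ k a s m K : ℕ) (hd : 1 ≤ d + 1) (hL : Odd (ℓ + 1) ∧ 1 < ℓ + 1) (hmK : m + K = k + a + 1 + s) (μ : Fin (d + 1)) :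
    N0 ℓ ((ℓ + 1) ^ a) k (fun _ => 2 * (ℓ + 1) ^ s) μ = (PV d ℓ m K hd hL).sitesPerDir 0 := by
  show (ℓ + 1) ^ k * ((ℓ + 1) * ((ℓ + 1) ^ a * (2 * (ℓ + 1) ^ s))) = 2 * (ℓ + 1) ^ (m + K - 0)
  rw [Nat.sub_zero, hmK]
  ring

/-! ## §2 Weights in the band (2.16) -/

/-- **A WEIGHT IN THE BAND**: at `c_f = 1`, `w_i := b₀·L^{j(i)D}·(L^{j(i)})⁻²` is positive and `w_i/(c_f/L^{j})² = b₀·L^{jD} ∈ [b₀, b₁]·L^{jD}`.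
[cite: Balaban1984PropagatorsII, (2.16) p.225] -/
theorem globalBand_witness {ℓ m K : ℕ} {hd : 1 ≤ d + 1} {hL : Odd (ℓ + 1) ∧ 1 < ℓ + 1} (Dm : B6SectADomainsV1.Domains (PV d ℓ m K hd hL))
    {b₀ b₁ : ℝ} (hb₀ : 0 < b₀) (hb₁ : b₀ ≤ b₁) :
    ∃ w : BondIdx Dm → ℝ, (∀ i, 0 < w i) ∧ GlobalBand b₀ b₁ 1 w := by
  have hL0 : (0 : ℝ) < (((ℓ + 1 : ℕ) : ℝ)) := by positivity
  refine ⟨fun i => b₀ * ((((ℓ + 1 : ℕ) : ℝ)) ^ (i.1.1 : ℕ)) ^ (d + 1) * (1 / (((ℓ + 1 : ℕ) : ℝ)) ^ (i.1.1 : ℕ)) ^ 2, fun i => by positivity, ?_⟩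
  intro i
  have hq : (1 / (((ℓ + 1 : ℕ) : ℝ)) ^ (i.1.1 : ℕ)) ^ 2 ≠ 0 := by positivity
  have hval : b₀ * ((((ℓ + 1 : ℕ) : ℝ)) ^ (i.1.1 : ℕ)) ^ (d + 1) * (1 / (((ℓ + 1 : ℕ) : ℝ)) ^ (i.1.1 : ℕ)) ^ 2 /
      (1 / (((ℓ + 1 : ℕ) : ℝ)) ^ (i.1.1 : ℕ)) ^ 2 = b₀ * ((((ℓ + 1 : ℕ) : ℝ)) ^ (i.1.1 : ℕ)) ^ (d + 1) := mul_div_cancel_right₀ _ hq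
  simp only [hval]
  exact ⟨le_rfl, mul_le_mul_of_nonneg_right hb₁ (by positivity)⟩

/-! ## §3 The exponent beyond both thresholds -/

/-- `L·L^a` exceeds every real threshold AND `R·L·L^a` every natural one, with `L^a ≥ 8`, for `a` large (`L ≥ 2`).
[cite: Balaban1984PropagatorsII, (2.2) p.224 («M is a size of big blocks and R is a big positive integer which will be fixed later»), bookkeeping] -/
theorem exists_exponent (ℓ : ℕ) (hℓ : 2 ≤ ℓ) (M₂ : ℝ) (N₁ R : ℕ) (hR : 1 ≤ R) :
    ∃ a : ℕ, 8 ≤ (ℓ + 1) ^ a ∧ M₂ ≤ ((ℓ : ℝ) + 1) * (((ℓ + 1) ^ a : ℕ) : ℝ) ∧ N₁ + 1 ≤ R * ((ℓ + 1) * (ℓ + 1) ^ a) := by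
  set a : ℕ := max (max 2 ⌈M₂⌉₊) (N₁ + 1) with ha
  have hL3 : 3 ≤ ℓ + 1 := by omega
  have hpow : a ≤ (ℓ + 1) ^ a := (Nat.lt_pow_self (by omega : 1 < ℓ + 1)).le
  refine ⟨a, ?_, ?_, ?_⟩
  · have h2 : 2 ≤ a := (le_max_left _ _).trans (le_max_left _ _)
    calc 8 ≤ 3 ^ 2 := by norm_num
      _ ≤ (ℓ + 1) ^ 2 := Nat.pow_le_pow_left hL3 2
      _ ≤ (ℓ + 1) ^ a := Nat.pow_le_pow_right (by omega) h2
  · have h1 : M₂ ≤ (⌈M₂⌉₊ : ℝ) := Nat.le_ceil M₂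
    have h2 : (⌈M₂⌉₊ : ℕ) ≤ a := (le_max_right _ _).trans (le_max_left _ _)
    have h3 : (⌈M₂⌉₊ : ℝ) ≤ (((ℓ + 1) ^ a : ℕ) : ℝ) := by exact_mod_cast h2.trans hpow
    have h4 : (((ℓ + 1) ^ a : ℕ) : ℝ) ≤ ((ℓ : ℝ) + 1) * (((ℓ + 1) ^ a : ℕ) : ℝ) :=
      le_mul_of_one_le_left (by positivity) (by linarith [(Nat.cast_nonneg ℓ : (0 : ℝ) ≤ ℓ)])
    linarith
  · have h2 : N₁ + 1 ≤ a := le_max_right _ _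
    calc N₁ + 1 ≤ a := h2
      _ ≤ (ℓ + 1) ^ a := hpow
      _ ≤ (ℓ + 1) * (ℓ + 1) ^ a := Nat.le_mul_of_pos_left _ (by omega)
      _ ≤ R * ((ℓ + 1) * (ℓ + 1) ^ a) := Nat.le_mul_of_pos_left _ hR

/-! ## §4 The witness -/

/-- **NON-VACUITY OF THE FULL k-LEVEL BINDER LIST AT `L = 5`**: for every `d`, `k ≥ 2`, thresholds `M₂`, `N₁` and band constants `0 < b₀ ≤ b₁` there are
V1 parameters `m, K`, `M_h = 5^a ≥ 8`, `R = 2·5²`, `P′_μ = 2·5²`, the identification `hN` of the torus with the V1 torus, a nested torus family `D` with sites at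
BOTH top levels `k` and `k − 1`, `k ≤ m + K`, every cube `Placed`, `M₂ ≤ L·M_h`, `N₁ + 1 ≤ R·L·M_h`, and weights `w > 0` with `GlobalBand b₀ b₁ 1 w` — the
hypotheses of `prop26_2136_kLevel_unconditional`, `prop27_kLevel_unconditional`, `cor28_kLevel_H(_DH)` are jointly satisfiable (their `4 ≤ ℓ` at `ℓ = 4`,
`c_f = 1 ≠ 0`). [cite: Balaban1984PropagatorsII, (2.1)–(2.4) p.224, (2.2) p.224 («M is a size of big blocks and R is a big positive integer which will be fixed later»),
Prop. 2.2 p.234 («M is sufficiently large»), (2.16) p.225] -/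
theorem kLevelFamily_nonvacuous_L5 (d k : ℕ) (hd : 1 ≤ d + 1) (hL : Odd (4 + 1) ∧ 1 < 4 + 1) (hk : 2 ≤ k) (M₂ : ℝ) (N₁ : ℕ)
    {b₀ b₁ : ℝ} (hb₀ : 0 < b₀) (hb₁ : b₀ ≤ b₁) :
    ∃ (m K Mh R a : ℕ) (P' : Fin (d + 1) → ℕ) (hN : ∀ μ, N0 4 Mh k P' μ = (PV d 4 m K hd hL).sitesPerDir 0)
      (D : TDomains d 4 Mh k P' R) (hk' : k ≤ m + K) (w : BondIdx (domT hN D hk') → ℝ),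
      Mh = (4 + 1) ^ a ∧ 8 ≤ Mh ∧ 2 * (4 + 1) ^ 2 ≤ R ∧ (∀ μ, 5 ≤ P' μ) ∧ (∀ μ, 12 ≤ P' μ) ∧
      (∀ c : ↥(cubes D.toDomains), Placed 4 k P' c.1) ∧
      M₂ ≤ (((4 : ℕ) : ℝ) + 1) * Mh ∧ N₁ + 1 ≤ R * ((4 + 1) * Mh) ∧
      (∀ i, 0 < w i) ∧ GlobalBand b₀ b₁ 1 w ∧
      (∃ x ∈ boxDom (N0 4 Mh k P'), D.lev x = k) ∧ (∃ x ∈ boxDom (N0 4 Mh k P'), D.lev x = k - 1) := by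
  obtain ⟨a, h8, hM₂, hN₁⟩ := exists_exponent 4 (by norm_num) M₂ N₁ (2 * (4 + 1) ^ 2) (by norm_num)
  have hMh : 1 ≤ (4 + 1) ^ a := Nat.one_le_pow _ _ (by norm_num)
  set P' : Fin (d + 1) → ℕ := fun _ => 2 * (4 + 1) ^ 2 with hP'
  have hP2 : ∀ μ : Fin (d + 1), 2 ≤ P' μ := fun μ => by simp only [hP']; norm_num
  obtain ⟨D, hD⟩ := exists_twoTop_TDomains d 4 ((4 + 1) ^ a) k P' (2 * (4 + 1) ^ 2) hk
  have hN : ∀ μ, N0 4 ((4 + 1) ^ a) k P' μ = (PV d 4 (k + a + 3) 0 hd hL).sitesPerDir 0 :=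
    fun μ => N0_V1_pow 4 k a 2 (k + a + 3) 0 hd hL (by ring) μ
  have hk' : k ≤ k + a + 3 + 0 := by omega
  obtain ⟨w, hw, hwb⟩ := globalBand_witness (domT hN D hk') hb₀ hb₁
  refine ⟨k + a + 3, 0, (4 + 1) ^ a, 2 * (4 + 1) ^ 2, a, P', hN, D, hk', w, rfl, h8, le_rfl,
    fun μ => by simp only [hP']; norm_num, fun μ => by simp only [hP']; norm_num,
    placed_all_cubes rfl (fun μ => by simp only [hP']; norm_num), ?_, hN₁, hw, hwb, ?_, ?_⟩
  · simpa using hM₂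
  · refine ⟨0, ?_, by rw [hD]; exact topLev_zero 4 k _⟩
    rw [mem_boxDom]; intro μ
    have := B6MultiLevelTorusOperator.one_le_N0 (ℓ := 4) (k := k) hMh (fun μ => le_trans (by norm_num) (hP2 μ)) μ
    simp only [Pi.zero_apply]; exact ⟨le_rfl, by exact_mod_cast this⟩
  · exact ⟨_, corner_mem_boxDom 4 k _ _ hMh hP2, by rw [hD]; exact topLev_corner 4 k _ hMh⟩

end Literature.MathematicalPhysics.QuantumFieldTheory.Balaban1983to89.B6KLevelFamilyWitnessV1
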